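import Literature.Geometry.Lorentzian.MetricDensityRatio
import Literature.Geometry.Manifold.TimeDerivativeSmooth
import Mathlib.Probability.Kernel.Composition.MeasureCompProd
import Mathlib.Probability.Kernel.Composition.IntegralCompProd
import HarnessLib

/-!
# Space-time kernel integrals and the time-reversed metric family (auxiliaries for the smooth
# heat kernel of a Ricci flow, Bamler 2020a, §2.3)

Folklore lemmas used to identify the heat kernel measures of a compact Ricci flow with smooth
densities (`HeatKernelSmoothDensity.lean`):

* `integral_toReal_rnDeriv_compProd_mul` — for a Markov kernel `κ : ℝ → M` absolutely continuous
  over a bounded measurable `T`, the space-time measure `(vol|_T) ⊗ κ` has a density `F` with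
  respect to `vol ⊗ μ₀` and `∫ F(σ, y) Z(y, σ) d(μ₀ ⊗ vol) = ∫_T ∫ Z(·, σ) dκ(σ) dσ`;
* `nonneg_of_ae_of_continuousOn` — a.e. nonnegative + continuous on an open set ⇒ nonnegative;
* `eqOn_of_forall_integral_mul_eq` — the fundamental lemma of the calculus of variations for
  continuous functions on an open subset of `ℝ` (nonnegative continuous test functions);
* `continuousOn_integral_of_continuousOn_prod_isOpen` — continuity in time of `∫_M F(σ, ·) dμ`
  on an open time set, `M` compact;
* `IsContMDiffFamilyOn.comp_neg`, `contMDiff_densityRatio_comp_neg`,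
  `contMDiff_deriv_densityRatio_div`, `differentiableAt_time_of_contMDiff` — the time-reversed
  family `σ ↦ h(−σ)`, its density ratio `ρ̃ = dV_{h(−σ)}/dV_{h(0)}` and `∂_σρ̃/ρ̃` are `C^∞`.

Everything is proved; no definitions, no named facts.

## References

* R. H. Bamler, *Entropy and heat kernel bounds on a Ricci flow background*, arXiv:2008.07093
  (2020), §2.3. [Bamler2020Entropy]
* P. Topping, *Lectures on the Ricci flow*, LMS Lecture Note Series 325 (2006), Prop. 2.3.12.
  [Topping2006]
-/

noncomputable section

open Bundle Set Function Filter Manifold MeasureTheory Measure TopologicalSpace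
  ProbabilityTheory
open scoped Manifold ContDiff Topology ENNReal NNReal

namespace Literature.Geometry.Riemannian

open Lorentzian Lorentzian.PseudoRiemannianMetric

/-! ### Measure-theoretic and real-variable lemmas -/

section General

variable {M : Type*} [TopologicalSpace M] [MeasurableSpace M]

/-- **Integration against a disintegrated space-time measure.** For a Markov kernel `κ` from `ℝ`
to `M` whose members over a bounded measurable `T ⊆ ℝ` are absolutely continuous with respect to
a finite measure `μ₀`, the space-time measure `(vol|_T) ⊗ κ` on `ℝ × M` has a density `F`
with respect to `vol ⊗ μ₀`, and for `Z` continuous and bounded on `M × T`,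
`∫ F(σ, y) Z(y, σ) d(μ₀ ⊗ vol) = ∫_T ∫ Z(y, σ) dκ(σ)(y) dσ`. [folklore] -/
theorem integral_toReal_rnDeriv_compProd_mul [BorelSpace M] {μ₀ : Measure M} [IsFiniteMeasure μ₀]
    {T : Set ℝ} (hT : MeasurableSet T) [IsFiniteMeasure (volume.restrict T)]
    (κ : Kernel ℝ M) [IsMarkovKernel κ] (hκ : ∀ σ ∈ T, κ σ ≪ μ₀)
    {Z : M × ℝ → ℝ} (hZ : Continuous Z) {C : ℝ} (hC : ∀ σ ∈ T, ∀ y, |Z (y, σ)| ≤ C)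
    [SecondCountableTopology M] :
    (volume.restrict T) ⊗ₘ κ ≪ (volume : Measure ℝ).prod μ₀ ∧
    Integrable (fun p : M × ℝ ↦
      (((volume.restrict T) ⊗ₘ κ).rnDeriv ((volume : Measure ℝ).prod μ₀) (p.2, p.1)).toReal)
      (μ₀.prod (volume : Measure ℝ)) ∧
    ∫ p, (((volume.restrict T) ⊗ₘ κ).rnDeriv ((volume : Measure ℝ).prod μ₀) (p.2, p.1)).toReal
        * Z p ∂(μ₀.prod (volume : Measure ℝ)) = ∫ σ in T, ∫ y, Z (y, σ) ∂(κ σ) := by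
  set μ : Measure (ℝ × M) := (volume.restrict T) ⊗ₘ κ with hμ
  set P : Measure (ℝ × M) := (volume : Measure ℝ).prod μ₀ with hP
  -- absolute continuity
  have hac : μ ≪ P := by
    have h1 : μ ≪ (volume.restrict T) ⊗ₘ (Kernel.const ℝ μ₀) :=
      Measure.AbsolutelyContinuous.compProd_right
        ((ae_restrict_iff' hT).2 (Eventually.of_forall fun σ hσ ↦ by
          rw [Kernel.const_apply]; exact hκ σ hσ))
    rw [Measure.compProd_const] at h1
    exact h1.trans (Measure.absolutelyContinuous_of_le
      (Measure.prod_mono Measure.restrict_le_self le_rfl))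
  set F : ℝ × M → ℝ≥0∞ := μ.rnDeriv P with hF
  have hFm : Measurable F := Measure.measurable_rnDeriv _ _
  refine ⟨hac, ?_, ?_⟩
  · refine integrable_toReal_of_lintegral_ne_top
      (hFm.comp measurable_swap).aemeasurable ?_
    have e : ∫⁻ p : M × ℝ, F (p.2, p.1) ∂(μ₀.prod (volume : Measure ℝ)) = ∫⁻ q, F q ∂P :=
      lintegral_prod_swap F
    rw [e, hF, Measure.lintegral_rnDeriv hac]
    exact measure_ne_top _ _
  · have e1 : ∫ p, (F (p.2, p.1)).toReal * Z p ∂(μ₀.prod (volume : Measure ℝ)) =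
        ∫ q, (F q).toReal * Z (q.2, q.1) ∂P := by
      rw [hP, ← integral_prod_swap]
      rfl
    rw [e1, hF, integral_toReal_rnDeriv_mul hac]
    -- `q ↦ Z (q.2, q.1)` is bounded `μ`-a.e. (the first coordinate lies in `T`)
    have hTae : ∀ᵐ q ∂μ, q.1 ∈ T :=
      Measure.ae_compProd_of_ae_fst κ (p := fun σ ↦ σ ∈ T) hT (ae_restrict_mem hT)
    have hint : Integrable (fun q : ℝ × M ↦ Z (q.2, q.1)) μ := by
      refine Integrable.mono' (integrable_const C)
        (hZ.comp continuous_swap).aestronglyMeasurable ?_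
      filter_upwards [hTae] with q hq
      rw [Real.norm_eq_abs]
      exact hC q.1 hq q.2
    rw [Measure.integral_compProd hint]

/-- **A continuous function which is a.e. nonnegative on an open set is nonnegative there**
(the measure charging open sets). [folklore] -/
theorem nonneg_of_ae_of_continuousOn {X : Type*} [TopologicalSpace X] [MeasurableSpace X]
    {μ : Measure X} [μ.IsOpenPosMeasure] {O : Set X} (hO : IsOpen O) {v : X → ℝ}
    (hv : ContinuousOn v O) (h : ∀ᵐ p ∂μ, p ∈ O → 0 ≤ v p) : ∀ p ∈ O, 0 ≤ v p := by
  intro p₀ hp₀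
  by_contra hneg
  rw [not_le] at hneg
  have hSo : IsOpen (O ∩ v ⁻¹' Iio 0) := hv.isOpen_inter_preimage hO isOpen_Iio
  have hSpos : 0 < μ (O ∩ v ⁻¹' Iio 0) := hSo.measure_pos μ ⟨p₀, hp₀, hneg⟩
  have hS0 : μ (O ∩ v ⁻¹' Iio 0) = 0 := by
    rw [measure_eq_zero_iff_ae_notMem]
    filter_upwards [h] with p hp ⟨hpO, hpv⟩
    exact absurd (hp hpO) (not_le.2 hpv)
  exact hSpos.ne' hS0

/-- **Fundamental lemma of the calculus of variations for continuous functions on an open subset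
of `ℝ`**: two functions continuous on an open `T ⊆ ℝ` whose integrals against every nonnegative
continuous compactly supported `θ` with `tsupport θ ⊆ T` agree, agree on `T`. [folklore] -/
theorem eqOn_of_forall_integral_mul_eq {T : Set ℝ} (hT : IsOpen T) {A B : ℝ → ℝ}
    (hA : ContinuousOn A T) (hB : ContinuousOn B T)
    (h : ∀ θ : ℝ → ℝ, Continuous θ → HasCompactSupport θ → tsupport θ ⊆ T → (∀ σ, 0 ≤ θ σ) →
      ∫ σ, θ σ * A σ = ∫ σ, θ σ * B σ) : EqOn A B T := by
  -- it suffices to exclude `A σ₀ < B σ₀` for every such pair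
  suffices key : ∀ A B : ℝ → ℝ, ContinuousOn A T → ContinuousOn B T →
      (∀ θ : ℝ → ℝ, Continuous θ → HasCompactSupport θ → tsupport θ ⊆ T → (∀ σ, 0 ≤ θ σ) →
        ∫ σ, θ σ * A σ = ∫ σ, θ σ * B σ) → ∀ σ₀ ∈ T, ¬ A σ₀ < B σ₀ by
    intro σ₀ hσ₀
    rcases lt_trichotomy (A σ₀) (B σ₀) with hlt | heq | hgt
    · exact absurd hlt (key A B hA hB h σ₀ hσ₀)
    · exact heq
    · exact absurd hgt (key B A hB hA (fun θ h1 h2 h3 h4 ↦ (h θ h1 h2 h3 h4).symm) σ₀ hσ₀)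
  intro A B hA hB h σ₀ hσ₀ hlt
  set ε : ℝ := (B σ₀ - A σ₀) / 2 with hε
  have hεpos : 0 < ε := by rw [hε]; linarith
  -- a closed interval around `σ₀` inside `T` on which `B - A ≥ ε`
  have hD : ContinuousAt (fun σ ↦ B σ - A σ) σ₀ :=
    ((hB.sub hA).continuousWithinAt hσ₀).continuousAt (hT.mem_nhds hσ₀)
  have hev : ∀ᶠ σ in 𝓝 σ₀, ε < B σ - A σ ∧ σ ∈ T :=
    (hD.eventually (lt_mem_nhds (by rw [hε]; linarith))).and (hT.mem_nhds hσ₀)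
  obtain ⟨δ', hδ'pos, hδ'⟩ := Metric.eventually_nhds_iff.1 hev
  set δ : ℝ := δ' / 2 with hδ
  have hδpos : 0 < δ := by rw [hδ]; linarith
  have hIcc : ∀ σ ∈ Icc (σ₀ - δ) (σ₀ + δ), ε < B σ - A σ ∧ σ ∈ T := fun σ hσ ↦
    hδ' (by rw [Real.dist_eq, abs_lt]; constructor <;> linarith [hσ.1, hσ.2])
  -- the hat function
  set θ : ℝ → ℝ := fun σ ↦ max 0 (δ - |σ - σ₀|) with hθ
  have hθc : Continuous θ := continuous_const.max (continuous_const.sub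
    ((continuous_id.sub continuous_const).abs))
  have hθnn : ∀ σ, 0 ≤ θ σ := fun σ ↦ le_max_left _ _
  have hθsupp : support θ ⊆ Ioo (σ₀ - δ) (σ₀ + δ) := by
    intro σ hσ
    rw [mem_support, hθ] at hσ
    have h1 : 0 < δ - |σ - σ₀| := by
      by_contra hle
      exact hσ (max_eq_left (not_lt.1 hle))
    have h2 := abs_lt.1 (by linarith : |σ - σ₀| < δ)
    exact ⟨by linarith [h2.1], by linarith [h2.2]⟩
  have hθts : tsupport θ ⊆ Icc (σ₀ - δ) (σ₀ + δ) :=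
    closure_minimal (hθsupp.trans Ioo_subset_Icc_self) isClosed_Icc
  have hθT : tsupport θ ⊆ T := fun σ hσ ↦ (hIcc σ (hθts hσ)).2
  have hθcs : HasCompactSupport θ :=
    HasCompactSupport.intro isCompact_Icc fun σ hσ ↦ by
      by_contra hne
      exact hσ (hθts (subset_tsupport _ hne))
  -- integrability of `θ A`, `θ B`
  have hint : ∀ {E : ℝ → ℝ}, ContinuousOn E T → Integrable (fun σ ↦ θ σ * E σ) := by
    intro E hE
    refine Continuous.integrable_of_hasCompactSupport (continuous_of_tsupport fun σ hσ ↦ ?_)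
      (hθcs.mul_right)
    have hσT : σ ∈ T := hθT (tsupport_mul_subset_left hσ)
    exact hθc.continuousAt.mul ((hE.continuousWithinAt hσT).continuousAt (hT.mem_nhds hσT))
  have hAB := h θ hθc hθcs hθT hθnn
  -- `∫ θ (B - A) = 0` but `≥ ε ∫ θ > 0`
  have hzero : ∫ σ, θ σ * (B σ - A σ) = 0 := by
    have e : (fun σ ↦ θ σ * (B σ - A σ)) = fun σ ↦ θ σ * B σ - θ σ * A σ := by
      funext σ; ring
    rw [e, integral_sub (hint hB) (hint hA), hAB, sub_self]
  have hθint : Integrable θ := hθc.integrable_of_hasCompactSupport hθcs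
  have hθpos : 0 < ∫ σ, θ σ := by
    rw [integral_pos_iff_support_of_nonneg hθnn hθint]
    refine (hθc.isOpen_support).measure_pos volume ⟨σ₀, ?_⟩
    rw [mem_support, hθ]
    simp only [sub_self, abs_zero, sub_zero]
    exact (max_eq_right hδpos.le).trans_ne hδpos.ne' |>.symm |> Ne.symm
  have hge : ε * ∫ σ, θ σ ≤ ∫ σ, θ σ * (B σ - A σ) := by
    rw [← MeasureTheory.integral_const_mul]
    refine integral_mono (hθint.const_mul ε) ?_ fun σ ↦ ?_
    · have e : (fun σ ↦ θ σ * (B σ - A σ)) = fun σ ↦ θ σ * B σ - θ σ * A σ := by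
        funext σ; ring
      rw [e]; exact (hint hB).sub (hint hA)
    · by_cases hσ : θ σ = 0
      · simp [hσ]
      · have hσI : σ ∈ Icc (σ₀ - δ) (σ₀ + δ) := Ioo_subset_Icc_self (hθsupp hσ)
        have := (hIcc σ hσI).1
        rw [mul_comm]
        exact mul_le_mul_of_nonneg_left this.le (hθnn σ)
  have : 0 < ε * ∫ σ, θ σ := mul_pos hεpos hθpos
  linarith

/-- Continuity on an open set of time of a parametric integral over a compact space, for an
integrand jointly continuous on `M × T`. [folklore] -/
theorem continuousOn_integral_of_continuousOn_prod_isOpen [CompactSpace M]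
    [OpensMeasurableSpace M] (μ : Measure M) [IsFiniteMeasure μ]
    {T : Set ℝ} (hT : IsOpen T) {F : ℝ → M → ℝ}
    (hF : ContinuousOn (fun z : M × ℝ ↦ F z.2 z.1) (univ ×ˢ T)) :
    ContinuousOn (fun σ ↦ ∫ y, F σ y ∂μ) T := by
  intro σ₀ hσ₀
  obtain ⟨δ, hδpos, hδ⟩ := Metric.isOpen_iff.1 hT σ₀ hσ₀
  have hsub : Icc (σ₀ - δ / 2) (σ₀ + δ / 2) ⊆ T := fun σ hσ ↦ hδ (by
    rw [Metric.mem_ball, Real.dist_eq, abs_lt]; constructor <;> linarith [hσ.1, hσ.2])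
  -- a uniform bound on the compact `M × [σ₀ - δ/2, σ₀ + δ/2]`
  obtain ⟨C, hC⟩ := (isCompact_univ.prod (isCompact_Icc (a := σ₀ - δ / 2) (b := σ₀ + δ / 2)))
    |>.exists_bound_of_continuousOn (hF.mono (prod_mono le_rfl hsub))
  have hslice : ∀ σ ∈ T, Continuous fun y ↦ F σ y := fun σ hσ ↦
    (hF.comp_continuous (continuous_id.prodMk continuous_const)
      fun y ↦ ⟨mem_univ _, hσ⟩ :)
  have hnhds : Icc (σ₀ - δ / 2) (σ₀ + δ / 2) ∈ 𝓝 σ₀ := Icc_mem_nhds (by linarith) (by linarith)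
  have hat : ContinuousAt (fun σ ↦ ∫ y, F σ y ∂μ) σ₀ := by
    refine continuousAt_of_dominated (bound := fun _ ↦ C) ?_ ?_ (integrable_const C) ?_
    · filter_upwards [hT.mem_nhds hσ₀] with σ hσ using (hslice σ hσ).aestronglyMeasurable
    · filter_upwards [hnhds] with σ hσ
      exact Eventually.of_forall fun y ↦ hC (y, σ) ⟨mem_univ _, hσ⟩
    · refine Eventually.of_forall fun y ↦ ?_
      have h1 : ContinuousWithinAt (fun z : M × ℝ ↦ F z.2 z.1) (univ ×ˢ T) (y, σ₀) :=
        hF _ ⟨mem_univ _, hσ₀⟩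
      have h2 : ContinuousAt (fun z : M × ℝ ↦ F z.2 z.1) (y, σ₀) :=
        h1.continuousAt ((isOpen_univ.prod hT).mem_nhds ⟨mem_univ _, hσ₀⟩)
      exact h2.comp (continuousAt_const.prodMk continuousAt_id)
  exact hat.continuousWithinAt

end General

/-! ### The time-reversed family and its density ratio -/

section Reversed

variable {m : ℕ} {H : Type*} [TopologicalSpace H]
  {I : ModelWithCorners ℝ (EuclideanSpace ℝ (Fin m)) H} [I.Boundaryless]
  {M : Type*} [TopologicalSpace M] [ChartedSpace H M] [IsManifold I ∞ M]
  {h : ℝ → PseudoRiemannianMetric I ∞ (EuclideanSpace ℝ (Fin m)) (TangentSpace I : M → Type _)}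

omit [I.Boundaryless] in
/-- The time reversal `σ ↦ h(−σ)` of a `C^∞` family of metrics is a `C^∞` family. [folklore] -/
theorem IsContMDiffFamilyOn.comp_neg (hh : IsContMDiffFamilyOn ∞ h univ) :
    IsContMDiffFamilyOn ∞ (fun σ ↦ h (-σ)) univ := by
  unfold IsContMDiffFamilyOn at hh ⊢
  rw [univ_prod_univ] at hh ⊢
  exact hh.comp (contMDiff_fst.prodMk contMDiff_snd.neg).contMDiffOn (fun _ _ ↦ mem_univ _)

/-- **The density ratio `ρ̃(σ, y) = dV_{h(−σ)}/dV_{h(0)}(y)` of the reversed family is `C^∞` on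
`M × ℝ`.** [cite: Topping2006, Prop. 2.3.12] -/
theorem contMDiff_densityRatio_comp_neg (hh : IsContMDiffFamilyOn ∞ h univ)
    (hR : ∀ r, (h r).IsRiemannian) :
    ContMDiff (I.prod 𝓘(ℝ, ℝ)) 𝓘(ℝ, ℝ) ∞
      (fun p : M × ℝ ↦ (h (-p.2)).densityRatio (h 0) p.1) := by
  have h1 := (IsContMDiffFamilyOn.comp_neg hh).contMDiffOn_densityRatio (g₀ := h 0)
    (fun s _ ↦ hR (-s)) (hR 0)
  rwa [univ_prod_univ, contMDiffOn_univ] at h1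

/-- The logarithmic time derivative `Q(σ, y) = ∂_σρ̃(σ, y)/ρ̃(σ, y)` of the reversed density ratio
is `C^∞` on `M × ℝ`. [folklore] -/
theorem contMDiff_deriv_densityRatio_div (hh : IsContMDiffFamilyOn ∞ h univ)
    (hR : ∀ r, (h r).IsRiemannian) :
    ContMDiff (I.prod 𝓘(ℝ, ℝ)) 𝓘(ℝ, ℝ) ∞ (fun p : M × ℝ ↦
      deriv (fun σ ↦ (h (-σ)).densityRatio (h 0) p.1) p.2 / (h (-p.2)).densityRatio (h 0) p.1) := by
  have h1 := contMDiff_densityRatio_comp_neg hh hR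
  have h2 := Literature.Geometry.Manifold.contMDiff_deriv_time (I := I)
    (u := fun σ y ↦ (h (-σ)).densityRatio (h 0) y) h1
  exact h2.div₀ h1 fun p ↦ (densityRatio_pos (hR _) (hR 0) _).ne'

omit [I.Boundaryless] [IsManifold I ∞ M] in
/-- Time slices of a `C^∞` function on `M × ℝ` are differentiable in time. [folklore] -/
theorem differentiableAt_time_of_contMDiff {f : M × ℝ → ℝ}
    (hf : ContMDiff (I.prod 𝓘(ℝ, ℝ)) 𝓘(ℝ, ℝ) ∞ f) (y : M) (σ : ℝ) :
    DifferentiableAt ℝ (fun s ↦ f (y, s)) σ := by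
  have h1 : ContMDiff 𝓘(ℝ, ℝ) 𝓘(ℝ, ℝ) ∞ (fun s : ℝ ↦ f (y, s)) :=
    hf.comp (contMDiff_const.prodMk contMDiff_id)
  exact (h1.contDiff.differentiable (by simp)).differentiableAt

end Reversed

end Literature.Geometry.Riemannian

end
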